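import Summits.QuantumFields.YangMills.Theorems.BalabanUVNodesN15KingModelOSExponentialClustering
import Literature.Probability.Distributions.TrigonometricDensityL2
import Literature.Probability.LatticeModels.LocalApproximationCountable

/-!
# BalabanUVNodes ∕ N15 — THE KING-MODEL RUNG (PART Ͳ-d₂): THE EXPONENTIAL ALGEBRA IS `L²(μ_∞)`-DENSE IN THE BOUNDED POSITIVE-TIME OBSERVABLES —
# every bounded `F` measurable in `{φ(x) : x₀ ≥ 0}` is, for every `δ > 0`, within `δ` in `∫‖F − P‖² dμ_∞` of a trigonometric polynomial `P = Σ_k a_k e^{iΣ_{z∈s} f_k(z)φ(z)}`, `s ⊆ {x₀ ≥ 0}`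
# (Track A, DAG node N15 = NE2; FAN-OUT v1.1 §N15 s3 «KING-MODEL RUNG»; count-neutral)

HONEST FRAMING.  Count-neutral (cell `pub-ymgap`, seat `pub-ymgap-dag-n15-e` g36; `--supports stmt-QuantumFields-27366 --as helper` = K3⁸).  King's `A = 0`, `g = 0` model
([King1986] C. King, Commun. Math. Phys. **102** (1986) 649–677): the FREE massive block field `μ_∞` of part Ϻ-n.  The density step of the Osterwalder–Schrader mass-gap argument
(Glimm–Jaffe 1987 §6.1: the exponential algebra generates `𝓔₊`): a bounded positive-time observable is an `L²` limit of bounded LOCAL observables (Lévy's upward theorem, tree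
`Literature.Probability.LatticeModels.exists_local_bdd_integral_sq_sub_lt`), a bounded local observable factors through finitely many coordinates and is an `L²` limit of trigonometric
polynomials in them (tree `Literature.Probability.Distributions.exists_trigPoly_sub_eLpNorm_lt`, the law of finitely many coordinates being a finite measure on `ℝ^W`), and real trigonometric
polynomials `α cos θ + β sin θ` are complex exponential sums `((α−iβ)∕2)e^{iθ} + ((α+iβ)∕2)e^{−iθ}`.  ★★★ **`king_exists_trigPoly_integral_normSq_sub_lt`**.  Part Ͳ-d₃ turns this into density of
`ι(exponential algebra)` in the OS Hilbert space.  NOT Bałaban's objects; NOT a node discharge; nothing continuum ∕ `ℝ⁴` ∕ Clay.  0 `sorry`, 0 def; standard axioms.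

WHAT THIS FILE PROVES (kernel).  `integral_sq_lt_of_eLpNorm_lt`, `sum_extend_mul_eq`, ★ `king_exists_realTrigPoly_integral_sq_sub_lt` (bounded local real observables), `cos_sin_comb_eq_cexp`,
`realTrigPoly_eq_cexpSum`, ★★★ **`king_exists_trigPoly_integral_normSq_sub_lt`**.

HONEST SCOPE.  King's free infinite-volume block field (`m² > 0`, every `d`).  N15 untouched; counts unmoved.
Locators (use): [King1986] Thm 2.1 (2.22) p.654; Glimm–Jaffe 1987 §6.1 Thm. 6.1.3 (`𝓔₊`), §6.2; Janson 1997 Thm 2.6.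
-/

noncomputable section

open scoped BigOperators Topology ComplexConjugate
open Filter MeasureTheory ProbabilityTheory Finset Complex

namespace Summit.QuantumFields.YangMills.BalabanUVNodes.N15KingModelRung.InfiniteVolume

open Literature.MathematicalPhysics.QuantumFieldTheory (positiveTimeSites positiveTimeEvents)
open Literature.Probability.LatticeModels (positiveEvents IsBoundedMeasurable exists_local_bdd_integral_sq_sub_lt apply_eq_apply_extend_of_measurable_cylinderEvents
  measurable_extendByZero)
open Literature.Probability.Distributions (exists_trigPoly_sub_eLpNorm_lt)

variable {d : ℕ}

/-! ## §1 Letters -/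

/-- From an `L²`-seminorm bound to a bound on `∫ f²`: `‖f‖_{L²(ν)} < ε ⇒ ∫ f² dν < ε²`. [folklore] -/
theorem integral_sq_lt_of_eLpNorm_lt {X : Type*} [MeasurableSpace X] {ν : Measure X} {f : X → ℝ} (hf : MemLp f 2 ν) {ε : ℝ} (hε : 0 < ε)
    (h : eLpNorm f 2 ν < ENNReal.ofReal ε) : ∫ x, (f x) ^ 2 ∂ν < ε ^ 2 := by
  rw [hf.eLpNorm_eq_integral_rpow_norm two_ne_zero ENNReal.ofNat_ne_top, ENNReal.ofReal_lt_ofReal_iff hε] at h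
  have h2 : (2 : ENNReal).toReal = 2 := by norm_num
  rw [h2] at h
  rw [show (2 : ℝ)⁻¹ = 1 / 2 by norm_num, ← Real.sqrt_eq_rpow, Real.sqrt_lt' hε] at h
  refine lt_of_le_of_lt (le_of_eq (integral_congr_ae (ae_of_all _ fun x => ?_))) h
  simp only [Real.rpow_two, Real.norm_eq_abs, sq_abs]

/-- Extending frequencies by zero off the window: `Σ_{z∈W} t̃(z)φ(z) = Σ_{j∈W} t(j)φ(j)` with `t̃ z = t ⟨z,·⟩` on `W`, `0` off `W`. [folklore] -/
theorem sum_extend_mul_eq (W : Finset (Fin (d + 1) → ℤ)) (t : ↥W → ℝ) (ω : (Fin (d + 1) → ℤ) → ℝ) :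
    ∑ z ∈ W, (fun z => if h : z ∈ W then t ⟨z, h⟩ else 0) z * ω z = ∑ j : ↥W, t j * ω j := by
  rw [← Finset.sum_coe_sort W]
  refine Finset.sum_congr rfl fun j _ => ?_
  simp only [j.2, dite_true]

/-- ★ **BOUNDED LOCAL REAL OBSERVABLES ARE `L²(μ_∞)`-LIMITS OF REAL TRIGONOMETRIC POLYNOMIALS OF THE WINDOW FIELDS**: for `G` measurable in `{φ(z) : z ∈ W}`, `|G| ≤ C`, and `δ > 0`,
`∫ (G − Σ_k(α_k cos(Σ_{z∈W}t_k(z)φ(z)) + β_k sin(…)))² dμ_∞ < δ` for suitable finitely many frequencies and coefficients (the law of `(φ(z))_{z∈W}` is a finite measure on `ℝ^W`; tree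
`exists_trigPoly_sub_eLpNorm_lt`). [cite: GlimmJaffe1987, §6.1 Thm. 6.1.3; Janson1997, Thm 2.6] -/
theorem king_exists_realTrigPoly_integral_sq_sub_lt {m2 : ℝ} (hm : 0 < m2) (W : Finset (Fin (d + 1) → ℤ)) {G : ((Fin (d + 1) → ℤ) → ℝ) → ℝ}
    (hG : Measurable[cylinderEvents (X := fun _ : Fin (d + 1) → ℤ => ℝ) ↑W] G) {C : ℝ} (hGb : ∀ ω, |G ω| ≤ C) {δ : ℝ} (hδ : 0 < δ) :
    ∃ (n : ℕ) (t : Fin n → (Fin (d + 1) → ℤ) → ℝ) (α β : Fin n → ℝ),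
      ∫ ω, (G ω - ∑ k, (α k * Real.cos (∑ z ∈ W, t k z * ω z) + β k * Real.sin (∑ z ∈ W, t k z * ω z))) ^ 2 ∂kingFieldInf m2 < δ := by
  classical
  haveI := isProbabilityMeasure_kingFieldInf (d := d) hm
  -- the window law
  set ρ : ((Fin (d + 1) → ℤ) → ℝ) → (↥W → ℝ) := fun ω j => ω j with hρ
  have hρm : Measurable ρ := measurable_pi_lambda _ fun j => measurable_pi_apply _
  set ν : Measure (↥W → ℝ) := (kingFieldInf m2).map ρ with hν
  haveI : IsProbabilityMeasure ν := Measure.isProbabilityMeasure_map hρm.aemeasurable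
  -- the factorised observable on `ℝ^W`
  set g : (↥W → ℝ) → ℝ := fun y => G (fun v => if h : v ∈ W then y ⟨v, h⟩ else 0) with hg
  have hgm : Measurable g := (hG.mono cylinderEvents_le_pi le_rfl).comp (measurable_extendByZero W)
  have hgb : ∀ y, |g y| ≤ C := fun y => hGb _
  have hfac : ∀ ω : (Fin (d + 1) → ℤ) → ℝ, G ω = g (ρ ω) := fun ω => (apply_eq_apply_extend_of_measurable_cylinderEvents W hG ω).trans rfl
  have hgL2 : MemLp g 2 ν := MemLp.of_bound hgm.aestronglyMeasurable C (ae_of_all _ fun y => by rw [Real.norm_eq_abs]; exact hgb y)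
  -- trigonometric approximation on `ℝ^W`
  obtain ⟨n, t, α, β, happ⟩ := exists_trigPoly_sub_eLpNorm_lt hgL2 (Real.sqrt_pos.mpr hδ)
  set p : (↥W → ℝ) → ℝ := fun y => ∑ k, (α k * Real.cos (∑ j, t k j * y j) + β k * Real.sin (∑ j, t k j * y j)) with hp
  have hpc : Continuous p := by
    simp only [hp]
    fun_prop
  have hpm : MemLp p 2 ν := by
    obtain ⟨B, hB⟩ : ∃ B, ∀ y, ‖p y‖ ≤ B := ⟨∑ k, (|α k| + |β k|), fun y => by
      simp only [hp, Real.norm_eq_abs]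
      refine (Finset.abs_sum_le_sum_abs _ _).trans (Finset.sum_le_sum fun k _ => (abs_add_le _ _).trans (add_le_add ?_ ?_))
      · rw [abs_mul]; exact mul_le_of_le_one_right (abs_nonneg _) (Real.abs_cos_le_one _)
      · rw [abs_mul]; exact mul_le_of_le_one_right (abs_nonneg _) (Real.abs_sin_le_one _)⟩
    exact MemLp.of_bound hpc.measurable.aestronglyMeasurable B (ae_of_all _ hB)
  have hlt : ∫ y, (g y - p y) ^ 2 ∂ν < δ := by
    have h := integral_sq_lt_of_eLpNorm_lt (hgL2.sub hpm) (Real.sqrt_pos.mpr hδ) happ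
    rwa [Real.sq_sqrt hδ.le] at h
  -- transport back to `μ_∞`
  refine ⟨n, fun k z => if h : z ∈ W then t k ⟨z, h⟩ else 0, α, β, ?_⟩
  have hint : ∫ y, (g y - p y) ^ 2 ∂ν = ∫ ω, (g (ρ ω) - p (ρ ω)) ^ 2 ∂kingFieldInf m2 := by
    rw [hν, integral_map hρm.aemeasurable]
    exact ((hgm.sub hpc.measurable).pow_const 2).aestronglyMeasurable
  rw [hint] at hlt
  refine lt_of_le_of_lt (le_of_eq (integral_congr_ae (ae_of_all _ fun ω => ?_))) hlt
  simp only [hfac ω, hp, hρ, sum_extend_mul_eq]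

/-! ## §2 Real trigonometric polynomials are complex exponential sums -/

/-- `α cos θ + β sin θ = ((α − iβ)∕2)e^{iθ} + ((α + iβ)∕2)e^{−iθ}`. [folklore] -/
theorem cos_sin_comb_eq_cexp (α β θ : ℝ) :
    ((α * Real.cos θ + β * Real.sin θ : ℝ) : ℂ)
      = ((α : ℂ) - (β : ℂ) * I) / 2 * Complex.exp ((θ : ℂ) * I) + ((α : ℂ) + (β : ℂ) * I) / 2 * Complex.exp (((-θ : ℝ) : ℂ) * I) := by
  rw [Complex.exp_mul_I, Complex.exp_mul_I]
  push_cast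
  rw [Complex.cos_neg, Complex.sin_neg]
  have hI : I * I = -1 := Complex.I_mul_I
  linear_combination (β * Complex.sin θ) * hI

/-- A real trigonometric polynomial of field sums as ONE complex exponential sum over the index type `Fin n ⊕ Fin n` (frequencies `t_k` and `−t_k`). [folklore] -/
theorem realTrigPoly_eq_cexpSum {n : ℕ} (s : Finset (Fin (d + 1) → ℤ)) (t : Fin n → (Fin (d + 1) → ℤ) → ℝ) (α β : Fin n → ℝ) (ω : (Fin (d + 1) → ℤ) → ℝ) :
    ((∑ k, (α k * Real.cos (∑ z ∈ s, t k z * ω z) + β k * Real.sin (∑ z ∈ s, t k z * ω z)) : ℝ) : ℂ)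
      = ∑ q : Fin n ⊕ Fin n,
          Sum.elim (fun k => ((α k : ℂ) - (β k : ℂ) * I) / 2) (fun k => ((α k : ℂ) + (β k : ℂ) * I) / 2) q
            * Complex.exp (((∑ z ∈ s, Sum.elim t (fun k z => -t k z) q z * ω z : ℝ) : ℂ) * I) := by
  rw [Fintype.sum_sum_type]
  simp only [Sum.elim_inl, Sum.elim_inr]
  rw [Complex.ofReal_sum, ← Finset.sum_add_distrib]
  refine Finset.sum_congr rfl fun k _ => ?_
  have e : ∑ z ∈ s, -t k z * ω z = -(∑ z ∈ s, t k z * ω z) := by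
    rw [← Finset.sum_neg_distrib]
    exact Finset.sum_congr rfl fun z _ => by ring
  rw [e]
  exact cos_sin_comb_eq_cexp (α k) (β k) _

/-! ## §3 The density theorem -/

/-- ★★★ **THE EXPONENTIAL ALGEBRA IS `L²(μ_∞)`-DENSE IN THE BOUNDED POSITIVE-TIME OBSERVABLES**: for every bounded complex observable `F` measurable in `{φ(x) : x₀ ≥ 0}` and every `δ > 0`
there is a trigonometric polynomial `P(φ) = Σ_k a_k exp(iΣ_{z∈s} f_k(z)φ(z))` with `s ⊆ {x₀ ≥ 0}` and `∫ ‖F − P‖² dμ_∞ < δ`.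
[cite: GlimmJaffe1987, §6.1 Thm. 6.1.3 (𝓔₊ generated by exponentials); Janson1997, Thm 2.6] -/
theorem king_exists_trigPoly_integral_normSq_sub_lt {m2 : ℝ} (hm : 0 < m2) {F : ((Fin (d + 1) → ℤ) → ℝ) → ℂ}
    (hF : IsBoundedMeasurable (positiveTimeEvents (d + 1) ℝ) F) {δ : ℝ} (hδ : 0 < δ) :
    ∃ (n : ℕ) (a : Fin n → ℂ) (s : Finset (Fin (d + 1) → ℤ)) (_ : ∀ z ∈ s, z ∈ positiveTimeSites (d + 1)) (f : Fin n → (Fin (d + 1) → ℤ) → ℝ),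
      ∫ ω, ‖F ω - ∑ k, a k * Complex.exp (((∑ z ∈ s, f k z * ω z : ℝ) : ℂ) * I)‖ ^ 2 ∂kingFieldInf m2 < δ := by
  classical
  haveI := isProbabilityMeasure_kingFieldInf (d := d) hm
  obtain ⟨hFm, C, hC⟩ := hF
  have hC0 : 0 ≤ C := (norm_nonneg _).trans (hC 0)
  -- real and imaginary parts
  have hRe : Measurable[positiveTimeEvents (d + 1) ℝ] fun ω => (F ω).re := Complex.measurable_re.comp hFm
  have hIm : Measurable[positiveTimeEvents (d + 1) ℝ] fun ω => (F ω).im := Complex.measurable_im.comp hFm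
  have hReb : ∀ ω, |(F ω).re| ≤ C := fun ω => (Complex.abs_re_le_norm _).trans (hC ω)
  have hImb : ∀ ω, |(F ω).im| ≤ C := fun ω => (Complex.abs_im_le_norm _).trans (hC ω)
  have hδ8 : 0 < δ / 8 := by positivity
  -- local approximants
  obtain ⟨W₁, hW₁, G₁, hG₁m, hG₁b, hG₁⟩ := exists_local_bdd_integral_sq_sub_lt (μ := kingFieldInf m2) hRe hC0 hReb hδ8
  obtain ⟨W₂, hW₂, G₂, hG₂m, hG₂b, hG₂⟩ := exists_local_bdd_integral_sq_sub_lt (μ := kingFieldInf m2) hIm hC0 hImb hδ8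
  set W := W₁ ∪ W₂ with hW
  have hWP : ∀ z ∈ W, z ∈ positiveTimeSites (d + 1) := fun z hz => by
    rcases Finset.mem_union.1 hz with h | h
    · exact hW₁ h
    · exact hW₂ h
  have hG₁m' : Measurable[cylinderEvents (X := fun _ : Fin (d + 1) → ℤ => ℝ) ↑W] G₁ := hG₁m.mono (cylinderEvents_mono (by simp [hW])) le_rfl
  have hG₂m' : Measurable[cylinderEvents (X := fun _ : Fin (d + 1) → ℤ => ℝ) ↑W] G₂ := hG₂m.mono (cylinderEvents_mono (by simp [hW])) le_rfl
  -- trigonometric approximants of the local parts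
  obtain ⟨n₁, t₁, α₁, β₁, h₁⟩ := king_exists_realTrigPoly_integral_sq_sub_lt hm W hG₁m' hG₁b hδ8
  obtain ⟨n₂, t₂, α₂, β₂, h₂⟩ := king_exists_realTrigPoly_integral_sq_sub_lt hm W hG₂m' hG₂b hδ8
  set p₁ : ((Fin (d + 1) → ℤ) → ℝ) → ℝ := fun ω => ∑ k, (α₁ k * Real.cos (∑ z ∈ W, t₁ k z * ω z) + β₁ k * Real.sin (∑ z ∈ W, t₁ k z * ω z)) with hp₁
  set p₂ : ((Fin (d + 1) → ℤ) → ℝ) → ℝ := fun ω => ∑ k, (α₂ k * Real.cos (∑ z ∈ W, t₂ k z * ω z) + β₂ k * Real.sin (∑ z ∈ W, t₂ k z * ω z)) with hp₂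
  -- the complex exponential sum `P = p₁ + i p₂` over the index `ι = (Fin n₁ ⊕ Fin n₁) ⊕ (Fin n₂ ⊕ Fin n₂)`
  set aι : (Fin n₁ ⊕ Fin n₁) ⊕ (Fin n₂ ⊕ Fin n₂) → ℂ :=
    Sum.elim (Sum.elim (fun k => ((α₁ k : ℂ) - (β₁ k : ℂ) * I) / 2) (fun k => ((α₁ k : ℂ) + (β₁ k : ℂ) * I) / 2))
      (fun q => I * Sum.elim (fun k => ((α₂ k : ℂ) - (β₂ k : ℂ) * I) / 2) (fun k => ((α₂ k : ℂ) + (β₂ k : ℂ) * I) / 2) q) with haι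
  set fι : (Fin n₁ ⊕ Fin n₁) ⊕ (Fin n₂ ⊕ Fin n₂) → (Fin (d + 1) → ℤ) → ℝ :=
    Sum.elim (Sum.elim t₁ fun k z => -t₁ k z) (Sum.elim t₂ fun k z => -t₂ k z) with hfι
  have hP : ∀ ω : (Fin (d + 1) → ℤ) → ℝ, ∑ q, aι q * Complex.exp (((∑ z ∈ W, fι q z * ω z : ℝ) : ℂ) * I) = (p₁ ω : ℂ) + I * (p₂ ω : ℂ) := by
    intro ω
    rw [Fintype.sum_sum_type]
    simp only [haι, hfι, Sum.elim_inl, Sum.elim_inr, hp₁, hp₂]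
    rw [realTrigPoly_eq_cexpSum W t₁ α₁ β₁ ω, realTrigPoly_eq_cexpSum W t₂ α₂ β₂ ω, Finset.mul_sum]
    congr 1
    refine Finset.sum_congr rfl fun q _ => ?_
    ring
  -- reindex by `Fin N`
  set e := Fintype.equivFin ((Fin n₁ ⊕ Fin n₁) ⊕ (Fin n₂ ⊕ Fin n₂)) with he
  refine ⟨Fintype.card ((Fin n₁ ⊕ Fin n₁) ⊕ (Fin n₂ ⊕ Fin n₂)), fun k => aι (e.symm k), W, hWP, fun k => fι (e.symm k), ?_⟩
  have hre : ∀ ω : (Fin (d + 1) → ℤ) → ℝ, ∑ k, aι (e.symm k) * Complex.exp (((∑ z ∈ W, fι (e.symm k) z * ω z : ℝ) : ℂ) * I) = (p₁ ω : ℂ) + I * (p₂ ω : ℂ) := by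
    intro ω
    rw [← hP ω]
    exact e.symm.sum_comp (fun q => aι q * Complex.exp (((∑ z ∈ W, fι q z * ω z : ℝ) : ℂ) * I))
  simp_rw [hre]
  -- pointwise: `‖F − P‖² = (Re F − p₁)² + (Im F − p₂)² ≤ 2(ReF−G₁)² + 2(G₁−p₁)² + 2(ImF−G₂)² + 2(G₂−p₂)²`
  have hpt : ∀ ω, ‖F ω - ((p₁ ω : ℂ) + I * (p₂ ω : ℂ))‖ ^ 2 = ((F ω).re - p₁ ω) ^ 2 + ((F ω).im - p₂ ω) ^ 2 := by
    intro ω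
    rw [Complex.sq_norm, Complex.normSq_apply]
    simp only [Complex.sub_re, Complex.sub_im, Complex.add_re, Complex.add_im, Complex.ofReal_re, Complex.ofReal_im, Complex.mul_re, Complex.mul_im,
      Complex.I_re, Complex.I_im]
    ring
  simp_rw [hpt]
  have hb : ∀ ω, ((F ω).re - p₁ ω) ^ 2 + ((F ω).im - p₂ ω) ^ 2
      ≤ 2 * ((F ω).re - G₁ ω) ^ 2 + 2 * (G₁ ω - p₁ ω) ^ 2 + (2 * ((F ω).im - G₂ ω) ^ 2 + 2 * (G₂ ω - p₂ ω) ^ 2) := fun ω => by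
    nlinarith [sq_nonneg ((F ω).re - G₁ ω - (G₁ ω - p₁ ω)), sq_nonneg ((F ω).im - G₂ ω - (G₂ ω - p₂ ω))]
  -- integrability of the four squares (bounded measurable on a probability space)
  have hFre : Measurable fun ω => (F ω).re := hRe.mono cylinderEvents_le_pi le_rfl
  have hFim : Measurable fun ω => (F ω).im := hIm.mono cylinderEvents_le_pi le_rfl
  have hG₁pi : Measurable G₁ := hG₁m.mono cylinderEvents_le_pi le_rfl
  have hG₂pi : Measurable G₂ := hG₂m.mono cylinderEvents_le_pi le_rfl
  have hp₁m : Measurable p₁ := by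
    simp only [hp₁]
    exact Finset.measurable_sum _ fun k _ => ((Real.measurable_cos.comp (Finset.measurable_sum _ fun z _ => (measurable_pi_apply z).const_mul _)).const_mul _).add
      ((Real.measurable_sin.comp (Finset.measurable_sum _ fun z _ => (measurable_pi_apply z).const_mul _)).const_mul _)
  have hp₂m : Measurable p₂ := by
    simp only [hp₂]
    exact Finset.measurable_sum _ fun k _ => ((Real.measurable_cos.comp (Finset.measurable_sum _ fun z _ => (measurable_pi_apply z).const_mul _)).const_mul _).add
      ((Real.measurable_sin.comp (Finset.measurable_sum _ fun z _ => (measurable_pi_apply z).const_mul _)).const_mul _)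
  have hpb : ∀ (n : ℕ) (α β : Fin n → ℝ) (t : Fin n → (Fin (d + 1) → ℤ) → ℝ) (ω : (Fin (d + 1) → ℤ) → ℝ),
      |∑ k, (α k * Real.cos (∑ z ∈ W, t k z * ω z) + β k * Real.sin (∑ z ∈ W, t k z * ω z))| ≤ ∑ k, (|α k| + |β k|) := by
    intro n α β t ω
    refine (Finset.abs_sum_le_sum_abs _ _).trans (Finset.sum_le_sum fun k _ => (abs_add_le _ _).trans (add_le_add ?_ ?_))
    · rw [abs_mul]; exact mul_le_of_le_one_right (abs_nonneg _) (Real.abs_cos_le_one _)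
    · rw [abs_mul]; exact mul_le_of_le_one_right (abs_nonneg _) (Real.abs_sin_le_one _)
  have hbdInt : ∀ {u v : ((Fin (d + 1) → ℤ) → ℝ) → ℝ} {A B : ℝ}, Measurable u → Measurable v → (∀ ω, |u ω| ≤ A) → (∀ ω, |v ω| ≤ B) →
      Integrable (fun ω => (u ω - v ω) ^ 2) (kingFieldInf m2) := by
    intro u v A B hu hv hA hB
    refine Integrable.of_bound ((hu.sub hv).pow_const 2).aestronglyMeasurable ((A + B) ^ 2) (ae_of_all _ fun ω => ?_)
    rw [Real.norm_eq_abs, abs_pow, pow_le_pow_iff_left₀ (abs_nonneg _) (by linarith [(abs_nonneg _).trans (hA ω), (abs_nonneg _).trans (hB ω)]) two_ne_zero]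
    exact (abs_sub _ _).trans (add_le_add (hA ω) (hB ω))
  have hI1 := hbdInt hFre hG₁pi hReb hG₁b
  have hI2 := hbdInt hG₁pi hp₁m hG₁b (fun ω => hpb n₁ α₁ β₁ t₁ ω)
  have hI3 := hbdInt hFim hG₂pi hImb hG₂b
  have hI4 := hbdInt hG₂pi hp₂m hG₂b (fun ω => hpb n₂ α₂ β₂ t₂ ω)
  have hIL := hbdInt hFre hp₁m hReb (fun ω => hpb n₁ α₁ β₁ t₁ ω)
  have hIR := hbdInt hFim hp₂m hImb (fun ω => hpb n₂ α₂ β₂ t₂ ω)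
  calc ∫ ω, ((F ω).re - p₁ ω) ^ 2 + ((F ω).im - p₂ ω) ^ 2 ∂kingFieldInf m2
      ≤ ∫ ω, 2 * ((F ω).re - G₁ ω) ^ 2 + 2 * (G₁ ω - p₁ ω) ^ 2 + (2 * ((F ω).im - G₂ ω) ^ 2 + 2 * (G₂ ω - p₂ ω) ^ 2) ∂kingFieldInf m2 :=
        integral_mono (hIL.add hIR) (((hI1.const_mul 2).add (hI2.const_mul 2)).add ((hI3.const_mul 2).add (hI4.const_mul 2))) hb
    _ = 2 * ∫ ω, ((F ω).re - G₁ ω) ^ 2 ∂kingFieldInf m2 + 2 * ∫ ω, (G₁ ω - p₁ ω) ^ 2 ∂kingFieldInf m2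
          + (2 * ∫ ω, ((F ω).im - G₂ ω) ^ 2 ∂kingFieldInf m2 + 2 * ∫ ω, (G₂ ω - p₂ ω) ^ 2 ∂kingFieldInf m2) := by
        rw [integral_add, integral_add, integral_add, integral_const_mul, integral_const_mul, integral_const_mul, integral_const_mul]
        all_goals first
          | exact (hI1.const_mul 2) | exact (hI2.const_mul 2) | exact (hI3.const_mul 2) | exact (hI4.const_mul 2)
          | exact ((hI1.const_mul 2).add (hI2.const_mul 2)) | exact ((hI3.const_mul 2).add (hI4.const_mul 2))
    _ < 2 * (δ / 8) + 2 * (δ / 8) + (2 * (δ / 8) + 2 * (δ / 8)) := by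
        have e1 : ∫ ω, (G₁ ω - p₁ ω) ^ 2 ∂kingFieldInf m2 < δ / 8 := by simpa only [hp₁] using h₁
        have e2 : ∫ ω, (G₂ ω - p₂ ω) ^ 2 ∂kingFieldInf m2 < δ / 8 := by simpa only [hp₂] using h₂
        gcongr
    _ = δ := by ring

end Summit.QuantumFields.YangMills.BalabanUVNodes.N15KingModelRung.InfiniteVolume
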